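import Mathlib.RingTheory.Smooth.Basic
import Mathlib.RingTheory.Ideal.Quotient.Operations
import Mathlib.Algebra.MvPolynomial.PDeriv
import Mathlib.Algebra.MvPolynomial.Variables
import Mathlib.LinearAlgebra.Matrix.Determinant.Basic
import HarnessLib

/-!
# Hu 2025 (arXiv:2507.21400v1), §8.1 (Lem. 8.1, Def. 8.2 «pleasant», Lem. 8.3 «max-minor») and the CHART content of
# Thm. 8.5 — row 110 file `b` = `S08MainTheorem/R110bMainTheorems.lean`, STATEMENTS-FIRST (rung M-Hu-min, D-0089).
# PRE-DRAFT by res-type-024 (gen 6; v3.1 gen 7: Lem. 8.1 AS PRINTED at the point + proof sentence `C67L64`, after the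
# lane-A pre-read 2026-08-27T05:26Z); NOT FILED before the 08:00Z re-pointing line names the row-110 owner.

**Status of the sources (D-0012): UNREFEREED PREPRINTS UNDER ADJUDICATION.** [Hu25] = Y. Hu, *Universal
characteristic-free resolution of singularities, I*, arXiv:2507.21400v1 (2025), TeX chunks `p0001…p0073` (locator of
record `chunk p<cc> l.<a>–<b>` = `C<cc>L<l>`, next to it the arXiv-v1 PDF page, cross-checked on the PDF text layer
`lit/res-lit-6/hu25/text`); [Hu22] = Y. Hu, arXiv:2203.03842v4 (2022), locator `p.N l.a–b` = `Hu22P<ppp>L<l>`. Every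
statement is typed as a `def … : Prop` CANDIDATE / real definition / STRUCTURE whose fields quote the printed
requirements, tagged `[claim: Hu2025 | Hu2022, status: under-review]`, consumed only as a hypothesis, never asserted; no
decl takes a side. No proofs, no `sorry`, no `instance`, no notation. AI typing is weaker than expert review.
STATUS: candidate statements under adjudication (D-0012/D-0089); not asserted.

ROW-110 FILE LAYOUT (res-type-024 pre-draft v3, 2026-08-27T05:3xZ; rationale in HOME/plan/tools/res-type-024/hu/README-hu110-bc.md):
a `S08MainTheorem/R110aSmooth` (I-SM: HuSmooth/Def8_4, IsHuResolution, AdmitsResolution/C71L67, AdmitsResolutionType/C03L19,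
IsHuBaseField/C67L4, HuSingular(_reg); deps: tree only) · b `S08MainTheorem/R110bMainTheorems` (§8.1 Lem8_1/Def8_2/Lem8_3
+ the CHART content of Thm 8.5; deps: Mathlib only) · c `S01S09Interface/R110cUniversalityInterface` (§9 matroids,
Prop9_1, Thm9_2/9_3/9_4 over LafforgueObjects; §1 Thm1_1, C09L16, C09L21; [Hu22] Thm1_1, P133L11; deps: a + Mathlib) ·
d `S08MainTheorem/R110dEllTransform` (Z_Γ as a scheme, the ℓ-transform tower STRUCTURE, Thm8_5/Thm8_6/Thm1_3 as
properties of a tower, the CLOSED platform consequences; deps: a + row 109 I-GA + row 101 I-PL) · e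
`S01S09Interface/R110eGammaOfMatroid` (Γ_d on the platform, C72L129, Hu22Setup + Hu22P131L40, C09L16_inst; deps: c + d).

THIS FILE (deps: Mathlib only). Read for it: chunks p0067 (l.1–127), p0070 (l.96–160), p0071 (l.1–62); PDF p.148–149,
p.156–158. §8.1's items are lemmas of the PROOF of Thm 8.5 (§8.2–8.3 Cases (α)/(β) are NOT typed in M-Hu-min, PARTITION-HU
§2) but numbered items of row 110: typed at CARRIER level in the §8 idiom «for any polynomial `f ∈ 𝕜[y]_{y ∈ Var_𝔙}`»
(chunk p0070 l.124) — blocks of relations as finite families of polynomials in the chart variables `V`, «appears in» =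
`MvPolynomial.vars`, Jacobian = `MvPolynomial.pderiv`, «at the point `𝐳`» = modulo a maximal ideal; the chart-choice
clauses («the chart `𝔙` … can be chosen», «there exists a preferred admissible chart») range over rows 106–108's chart data
and enter as PARAMETERS; «blowup-relevant» (chunk p0067 l.38–41) is informal in print ⇒ predicate parameter + its printed
example clause. The chart content of Thm 8.5 (Jacobian criterion on a preferred admissible chart of `ℛ̃_ℓ`, `Z̃_{ℓ,Γ} ∩ 𝔙`
cut out by Cor. 7.6's equations (8.14)/(8.15)) is `Thm8_5_chart` (Mathlib `Algebra.Smooth 𝔽 (A ⧸ zIdeal)`) with the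
hypotheses «`Z_Γ` integral» / «`𝔙` is an admissible chart of `ℛ̃_ℓ` carrying the ℓ-transform datum» as PARAMETERS
`hInt isEllChart : Prop`, exactly as row 109's `S07GammaSchemes.Cor7_6`. The SCHEME-level Thm 8.5/8.6/1.3 are in file d.
-/

noncomputable section

open _root_.MvPolynomial

namespace Literature.AlgebraicGeometry.Hu2025.Statements.S08MainTheorem

universe u v w

/-! ## Thm 8.5 at CHART level (proof text chunk p0070 l.96–160, p0071 l.1–62; PDF p.156–158) -/

/-- **Thm 8.5 at CHART level — what the proof argues** (chunk p0070 l.96–160, p0071 l.1–62; PDF p.156–158: «Fix any closed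
point `𝐳 ∈ Z̃_{ℓ,Γ} ⊂ 𝒱̃_ℓ`. We let `𝔙` be a admissible affine chart [sic] containing the point `𝐳` … By Corollary 7.6,
the scheme `Z̃_{ℓ,Γ} ∩ 𝔙`, if nonempty, as a closed subscheme of the chart `𝔙` of `ℛ̃_ℓ`, is defined by `y, y ∈ Γ̃⁰_𝔙;
y − 1, y ∈ Γ̃¹_𝔙; ℬ^gov_𝔙, ℬ^frb_𝔙, L_{𝔉,𝔙}` … Hence, `Z̃_{ℓ,Γ}` is smooth at `𝐳`»). For the coordinate ring `A` of an
admissible affine chart `𝔙` of `ℛ̃_ℓ` (an `𝔽`-algebra; rows 106–108) carrying the ℓ-transform datum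
of row 109 (Cor. 7.6; its `GammaTransformChart` fields `zIdeal` = the chart ideal of `Z̃_{ℓ,Γ} ∩ 𝔙` and `zDagger` =
that of `Z̃†_{ℓ,Γ} ∩ 𝔙` are passed here as two ideals, so that this file needs no row-109 import): `Z_Γ` integral ⇒ `A ⧸ zIdeal` and `A ⧸ zDagger` are smooth `𝔽`-algebras (Mathlib `Algebra.Smooth`
= formally smooth of finite presentation; smoothness of a scheme over a field is local, so this is the chart content
of «`Z̃_{ℓ,Γ}` is smooth over `Spec 𝔽`»). The hypotheses «`Z_Γ` is integral» and «`𝔙` is an admissible affine chart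
of `ℛ̃_ℓ` and `D` its ℓ-transform datum» are PARAMETERS `hInt isEllChart : Prop` (instantiated by I-GA /
rows 106–109), as in `S07GammaSchemes.Cor7_6`. [claim: Hu2025, status: under-review]
STATUS: candidate statement under adjudication (D-0012/D-0089); not asserted. -/
def Thm8_5_chart (𝔽 : Type u) [Field 𝔽] {A : Type w} [CommRing A] [Algebra 𝔽 A]
    (hInt isEllChart : Prop) (zIdeal zDagger : Ideal A) : Prop :=
  hInt → isEllChart → Algebra.Smooth 𝔽 (A ⧸ zIdeal) ∧ Algebra.Smooth 𝔽 (A ⧸ zDagger)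

/-- **Thm 8.5, the clause «In particular, when `Γ = ∅`, we obtain that `𝒱̃_ℓ` is smooth over `Spec 𝔽`» at CHART level**
(chunk p0070 l.86–87; proof chunk p0071 l.3–27: «`Z̃_{ℓ,∅} = 𝒱̃_ℓ` … `dim T_𝐳(𝒱̃_ℓ) = dim 𝒱̃_ℓ`, thus, `𝒱̃_ℓ` is smooth
at `𝐳`»): for the coordinate ring `A` of an admissible affine chart `𝔙` of `ℛ̃_ℓ` with `vIdeal` = the chart ideal of
`𝒱̃_ℓ ∩ 𝔙` (row 108 `WpEllChart.vIdeal` at the last stage), `A ⧸ vIdeal` is a smooth `𝔽`-algebra. Parameter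
`isEllChart : Prop` as above. [claim: Hu2025, status: under-review]
STATUS: candidate statement under adjudication (D-0012/D-0089); not asserted. -/
def Thm8_5_chart_empty (𝔽 : Type u) [Field 𝔽] {A : Type w} [CommRing A] [Algebra 𝔽 A] (isEllChart : Prop)
    (vIdeal : Ideal A) : Prop :=
  isEllChart → Algebra.Smooth 𝔽 (A ⧸ vIdeal)

/-! ## §8.1 «Preparing for applying the Jacobian criterion» (chunk p0067 l.10–127; PDF p.148–149) — CARRIER level -/

section JacobianPreparation

variable {R : Type u} [CommRing R] {V : Type v} [DecidableEq V]

/-- **«appears in»** (Def. 8.2, chunk p0067 l.91–93: «any variable `y ∈ Var_𝔙` that appears in some relation of a block»)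
for a polynomial in the chart variables: `y ∈ f.vars` (Mathlib `MvPolynomial.vars`). OURS vocabulary (standard), in
the §8 idiom «for any polynomial `f ∈ 𝕜[y]_{y ∈ Var_𝔙}`» (chunk p0070 l.124). [claim: Hu2025, status: under-review]
STATUS: candidate statement under adjudication (D-0012/D-0089); not asserted. -/
def AppearsIn (y : V) (f : MvPolynomial V R) : Prop := y ∈ f.vars

/-- **Hu 2025, Definition 8.2 («pleasant»)** (chunk p0067 l.85–93; PDF p.149), verbatim: «Consider the ordered set of
blocks of relations `𝔊 = {𝔊_{F_1} < ⋯ < 𝔊_{F_Υ}}`. Fix and consider any variable `y ∈ Var_𝔙` that appears in some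
relation of a block `𝔊_{F_k}` of `𝔊` in the above, for some `k ∈ [Υ]`. We say that `y` is pleasant if `y` does not
appear in any relation of any earlier block `𝔊_{F_i}` with `i < k`.» Typed for an ordered family of blocks
`blocks : Fin Υ → Finset (MvPolynomial V R)` (the relations of block `𝔊_{F_k}` on the chart, rows 105/108: `B^gov`,
`L_F` …; DATA), a block index `k` and a variable index `y`: `y` appears in some relation of block `k` and in no
relation of a block `i < k`. (The printed «pleasant» depends on `k`; when `y` appears in several blocks the text's `k`
is the one fixed in the sentence — the least such `k` makes every appearing variable pleasant; typed with `k` explicit,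
sic.) [claim: Hu2025, status: under-review]
STATUS: candidate statement under adjudication (D-0012/D-0089); not asserted. -/
def IsPleasant {Υ : ℕ} (blocks : Fin Υ → Finset (MvPolynomial V R)) (k : Fin Υ) (y : V) : Prop :=
  (∃ f ∈ blocks k, AppearsIn y f) ∧ ∀ i : Fin Υ, i < k → ∀ f ∈ blocks i, ¬ AppearsIn y f

/-- **Hu 2025, Definition 8.2** — numbered alias of `IsPleasant` (chunk p0067 l.85–93; PDF p.149).
[claim: Hu2025, status: under-review]
STATUS: candidate statement under adjudication (D-0012/D-0089); not asserted. -/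
abbrev Def8_2 {Υ : ℕ} (blocks : Fin Υ → Finset (MvPolynomial V R)) (k : Fin Υ) (y : V) : Prop :=
  IsPleasant blocks k y

/-- **«the Jacobian `J(𝔊_{𝔙,F})` admits a maximal minor `J^*(𝔊_{𝔙,F})` such that it is an invertible square matrix at
`𝐳`, and all the variables that are used to compute `J^*(𝔊_{𝔙,F})` are pleasant»** (Lem. 8.3, chunk p0067 l.102–108;
PDF p.149) at CARRIER level: for the relations `g : Fin c → MvPolynomial V R` of the block (an enumeration of
`blocks k`), the point `𝐳` read as a maximal ideal `𝔪` of the chart's polynomial ring, there is an injective choice of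
`c` variables `col : Fin c ↪ V` such that the `c × c` minor `det (∂ g_i / ∂ y_{col j})` (Mathlib `MvPolynomial.pderiv`,
`Matrix.det`) is a unit at `𝐳` (`∉ 𝔪`) and every `y_{col j}` is pleasant. «maximal minor» = a minor of size the number
of relations (full row rank at `𝐳`). OURS rendering of the printed clause. [claim: Hu2025, status: under-review]
STATUS: candidate statement under adjudication (D-0012/D-0089); not asserted. -/
def HasInvertiblePleasantMinorAt {Υ c : ℕ} (blocks : Fin Υ → Finset (MvPolynomial V R)) (k : Fin Υ)
    (g : Fin c → MvPolynomial V R) (𝔪 : Ideal (MvPolynomial V R)) : Prop :=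
  ∃ col : Fin c ↪ V,
    Matrix.det (Matrix.of fun i j => pderiv (col j) (g i)) ∉ 𝔪 ∧ ∀ j : Fin c, IsPleasant blocks k (col j)

/-- **Hu 2025, Lemma 8.3 («max-minor»)** (chunk p0067 l.97–108; PDF p.149), verbatim: «Fix any closed point `𝐳 ∈ 𝒱̃_ℓ`.
Consider any `𝐅 ∈ 𝔉`. Then, there exists a preferred admissible chart `𝔙` of `ℛ̃_ℓ` containing the point `𝐳` such that
the Jacobian `J(𝔊_{𝔙,F})` admits a maximal minor `J^*(𝔊_{𝔙,F})` such that it is an invertible square matrix at `𝐳`,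
and all the variables that are used to compute `J^*(𝔊_{𝔙,F})` are pleasant with respect to the list
`𝔊 = {𝔊_{F_1} < ⋯ < 𝔊_{F_Υ}}`.» PARAMETRIC in the family of preferred admissible charts of `ℛ̃_ℓ` containing `𝐳` (rows
106–108; Def. 6.12 «preferred»): `charts : ι → (Fin Υ → Finset (MvPolynomial V R))` gives, for each such chart, its
ordered blocks of relations in its own variables (a common index type `V` for `Var_𝔙`, as in rows 106/108), `point :
ι → Ideal (MvPolynomial V R)` the maximal ideal of `𝐳` on that chart, `enum` an enumeration of block `k` (= `𝔊_{𝔙,F}`,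
`F = F_k`); the hypothesis «`𝐳 ∈ 𝒱̃_ℓ` is a closed point and `ι` indexes ALL preferred admissible charts of `ℛ̃_ℓ`
containing `𝐳`» is the parameter `isChartFamilyAt : Prop`. Conclusion: some chart in the family has an invertible
pleasant maximal minor for block `k` at `𝐳`. [claim: Hu2025, status: under-review]
STATUS: candidate statement under adjudication (D-0012/D-0089); not asserted. -/
def Lem8_3 {ι : Type w} {Υ : ℕ} (isChartFamilyAt : Prop) (charts : ι → (Fin Υ → Finset (MvPolynomial V R)))
    (point : ι → Ideal (MvPolynomial V R)) (k : Fin Υ) (c : ι → ℕ)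
    (enum : ∀ a : ι, Fin (c a) → MvPolynomial V R) : Prop :=
  isChartFamilyAt → (∀ a, Set.range (enum a) = ↑(charts a k)) →
    ∃ a : ι, (point a).IsMaximal ∧ HasInvertiblePleasantMinorAt (charts a) k (enum a) (point a)

/-- **«blowup-relevant at `𝐳`»** (chunk p0067 l.38–41; PDF p.148), verbatim: «Given any point `𝐳` on a chart, we say a
variable is blowup-relevant at `𝐳` if it can appear in the local blowup ideal `⟨y_0', y_1'⟩` as above such that the
corresponding blowup center contains `𝐳`. For example, a variable is not blowup-relevant at `𝐳` if it does not vanish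
at `𝐳`.» An INFORMAL notion («can appear … as above» ranges over the ℘-blow-ups `(kτ)μh ∈ Index_{Φ_k}` of rows
107–108 whose chart centre `⟨y_0', y_1'⟩` contains `𝐳`); recorded as a predicate PARAMETER `IsBlowupRelevantAt : V → Prop`
of Lem. 8.1 with this sentence as its specification; the «For example» clause is typed as the constraint
`BlowupRelevantSpec`: a variable not vanishing at `𝐳` (`X y ∉ 𝔪`) is not blowup-relevant.
[claim: Hu2025, status: under-review]
STATUS: candidate statement under adjudication (D-0012/D-0089); not asserted. -/
def BlowupRelevantSpec (IsBlowupRelevantAt : V → Prop) (𝔪 : Ideal (MvPolynomial V R)) : Prop :=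
  ∀ y : V, (X y : MvPolynomial V R) ∉ 𝔪 → ¬ IsBlowupRelevantAt y

/-- **Hu 2025, proof of Lemma 8.1 — the sentence «`ξ_1` is invertible along `𝒱̃ ∩ 𝔙`»** (chunk p0067 l.57–67,
the sentence itself l.64–65; PDF p.148), verbatim: «Suppose `𝔙` lies over `(ξ_0 ≡ 1)`. Then, by taking proper
transforms, we obtain `B_𝔙 = a − ξ_1 b` where `a` and `b` are some monomials. Because `y_0'` is the largest variable in
the term `T^+_{𝔙,(kτ)}`, by the order of the ℘-blowups, we have that `B_𝔙` terminates. Hence, `ξ_1` is invertible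
along `𝒱̃_{(℘_(kτ)𝔯_μ𝔰_h)} ∩ 𝔙`. Thus, by shrinking the chart if necessary, we can switch to the chart `(ξ_1 ≡ 1)`.»
Frame (chunk p0067 l.14–36): the ℘-blowup `π : ℛ̃_{(℘_(kτ)𝔯_μ𝔰_h)} → ℛ̃_{(℘_(kτ)𝔯_μ𝔰_{h−1})}` at `(kτ)μh ∈ Index_{Φ_k}`,
admissible charts `𝔙` over `𝔙'`, the local blow-up ideal `⟨y_0', y_1'⟩` with `y_0' ∈ T^+_{𝔙',(kτ)}`,
`y_1' ∈ T^-_{𝔙',(kτ)}`, `B_{𝔙',(kτ)} = T^+ − T^-`, the factor `ℙ_{[ξ_0,ξ_1]}`, and the hypothesis of Lem. 8.1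
(l.44–46: `y_0'` is the largest blowup-relevant variable at `𝐳` among the variables of `T^+_{𝔙',(kτ)}`).
CARRIER-level, PARAMETRIC rendering over the chart `(ξ_0 ≡ 1)` lying over `𝔙'` (rows 106–108: its polynomial ring in
the variables `V`, `ξ_1 ∈ V` the new variable, `vIdeal` = the chart ideal of `𝒱̃_{(℘_(kτ)𝔯_μ𝔰_h)} ∩ 𝔙`, `𝔪` = the
ideal of the point `𝐳`, `Tplus'` the index set of the variables of `T^+_{𝔙',(kτ)}`, the total order of chunk p0067
l.35–36 as `lt`, `y₀'` the first centre variable): IF `y_0'` is blowup-relevant at `𝐳`, every variable of `T^+_{𝔙'}`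
larger than `y_0'` is not, and the example clause `BlowupRelevantSpec` holds, THEN `ξ_1` is a unit modulo `vIdeal`
(«invertible along `𝒱̃ ∩ 𝔙`» read scheme-theoretically on the WHOLE chart). This is the CHART-GLOBAL sentence the
proof argues; it is STRONGER than the printed statement of Lem. 8.1, which speaks of the point `𝐳` only and is typed
next as `Lem8_1` (for `vIdeal ≤ 𝔪 ≠ ⊤` this form implies that one); both are recorded, labelled. The clause «so that
`y_0 ∈ T^+_{𝔙,(kτ)}`» (bookkeeping of row 108's term data on the chart `(ξ_1 ≡ 1)`, where `ξ_0 = y_0`, l.69–74) is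
the parameter `y0InTplus : Prop`. [claim: Hu2025, status: under-review]
STATUS: candidate statement under adjudication (D-0012/D-0089); not asserted. -/
def C67L64 (IsBlowupRelevantAt : V → Prop) (𝔪 : Ideal (MvPolynomial V R)) (Tplus' : Finset V)
    (lt : V → V → Prop) (y₀' ξ₁ : V) (vIdeal : Ideal (MvPolynomial V R)) (y0InTplus : Prop) : Prop :=
  BlowupRelevantSpec IsBlowupRelevantAt 𝔪 → y₀' ∈ Tplus' → IsBlowupRelevantAt y₀' →
    (∀ y ∈ Tplus', lt y₀' y → ¬ IsBlowupRelevantAt y) →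
      IsUnit (Ideal.Quotient.mk vIdeal (X ξ₁ : MvPolynomial V R)) ∧ y0InTplus

/-- **Hu 2025, Lemma 8.1** (chunk p0067 l.43–48; PDF p.148), verbatim: «Let `⟨y_0', y_1'⟩` be the local blowup ideal as in
the above such that `y_0'` is the largest blowup-relevant variable at the point `𝐳` among all the variables of
`T^+_{𝔙',(kτ)}`. Then, the chart `𝔙` containing the point `𝐳` can be chosen to lie over `(ξ_1 ≡ 1)` so that the proper
transform `y_0` of `y_0'` belongs to the term `T^+_{𝔙,(kτ)}`.» AS PRINTED, AT THE POINT `𝐳` (frame and carrier-level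
parameters as in `C67L64`, over the chart `(ξ_0 ≡ 1)` lying over `𝔙'` — the only one of the two charts over `𝔙'` on
which «`𝐳` lies over `(ξ_1 ≡ 1)`» has content, `𝐳` lying there trivially otherwise): `𝐳` a point of that chart
(`𝔪` a prime ideal of its polynomial ring; for the closed points of §8.2 it is maximal) lying on
`𝒱̃_{(℘_(kτ)𝔯_μ𝔰_h)}` («`𝐳` on `𝒱̃ ∩ 𝔙`» = `vIdeal ≤ 𝔪`): IF `y_0'` is blowup-relevant at `𝐳`, every variable of
`T^+_{𝔙'}` larger than `y_0'` is not (l.44–46), and the example clause `BlowupRelevantSpec` (chunk p0067 l.41) holds,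
THEN `ξ_1` does not vanish at `𝐳` (`X ξ_1 ∉ 𝔪`), i.e. `𝐳` lies in the chart `(ξ_1 ≡ 1)` — «the chart `𝔙` containing
`𝐳` can be chosen to lie over `(ξ_1 ≡ 1)`» —, AND the clause «so that `y_0 ∈ T^+_{𝔙,(kτ)}`» (bookkeeping of row 108's
term data on that chart, `ξ_0 = y_0` the proper transform of `y_0'`, l.69–74), recorded as the parameter
`y0InTplus : Prop`. The chart-global sentence of the PROOF («`ξ_1` invertible along `𝒱̃ ∩ 𝔙`», l.64–65) is the sibling
`C67L64`. [claim: Hu2025, status: under-review]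
STATUS: candidate statement under adjudication (D-0012/D-0089); not asserted. -/
def Lem8_1 (IsBlowupRelevantAt : V → Prop) (𝔪 : Ideal (MvPolynomial V R)) (Tplus' : Finset V)
    (lt : V → V → Prop) (y₀' ξ₁ : V) (vIdeal : Ideal (MvPolynomial V R)) (y0InTplus : Prop) : Prop :=
  𝔪.IsPrime → vIdeal ≤ 𝔪 → BlowupRelevantSpec IsBlowupRelevantAt 𝔪 → y₀' ∈ Tplus' → IsBlowupRelevantAt y₀' →
    (∀ y ∈ Tplus', lt y₀' y → ¬ IsBlowupRelevantAt y) →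
      (X ξ₁ : MvPolynomial V R) ∉ 𝔪 ∧ y0InTplus

end JacobianPreparation

end Literature.AlgebraicGeometry.Hu2025.Statements.S08MainTheorem

end
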